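import Summits.Ventures.HodgeRepro2.T5RightCosetAction
import Summits.Ventures.HodgeRepro2.T5L2Partition
import Mathlib.MeasureTheory.Constructions.BorelSpace.Basic

/-!
# T5ComponentHilbertSum — (A3) STEP 1: «L^{K_f} = ⊕_{i=1}^{h} L²(Γ_i\G_∞) as unitary G_∞-modules»

Cell pub-hodge-repro2, seat p5, Tier 5 (route/T5-N4-p5.md, N4.3 (A3) STEP 1, l. 147), the LAST
sentence of STEP 1 assembled from the earlier rows on the double coset space
`FullQuotient H K = H\(A × B)/({1} × K)` (p2's rows 30–31, row 39):

* the components `range (toFull q)` (= the `G_∞`-orbits, row 39) are MEASURABLE for the quotient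
  σ-algebra of row 44 (`measurableSet_range_toFull`: their preimages in `A × B` are open);
* they form a finite measurable partition (p2's `iUnion_range_toFull` /
  `pairwise_disjoint_range_toFull`, row 39's `finite_finiteQuotient` for a compact quotient), so
  row 19's `isHilbertSum_V` gives **`isHilbertSum_components`**:
  `L²(FullQuotient H K, ν) = ⊕̂_q V_q` with `V_q = {f ∣ f = 0 a.e. off the q-th component}`
  (`L²(Γ_q\G_∞)` in the prose, through row 39's homeomorphism `Component H K q ≃ₜ range (toFull q)`);
* each `V_q` is stable under row 39's action of `A = G_∞` (`regularRep_mem_V`: the components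
  are `A`-invariant sets, row 39's `finitePart_smul`), i.e. the Hilbert sum is one of unitary
  `A`-modules (`instMeasurableConstSMul` makes row 36's regular representation available on the
  double coset space).

The measure `ν` is any `A`-invariant measure on the double coset space (the prose's «induced by the
Haar measure of `G(𝔸)`», row 29); the identification of `V_q` with `L²` of the component (row 21's
`restrictEquiv`) and with `L²(Γ_q\G_∞)` through the homeomorphism stays prose.  Mathlib only
besides the cell's own rows.  Axioms: propext, Classical.choice, Quot.sound.  README §8(d): uses an
L-value-free non-vanishing device: NO.
-/

namespace Summit.Ventures.HodgeRepro2.T5ComponentHilbertSum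

open MeasureTheory Topology
open Summit.Ventures.HodgeRepro2.T5DoubleCosetDecomposition
  Summit.Ventures.HodgeRepro2.T5DoubleCosetTopology Summit.Ventures.HodgeRepro2.T5RegularRep
  Summit.Ventures.HodgeRepro2.T5L2Partition

variable {A B : Type*} [Group A] [Group B] (H : Subgroup (A × B)) (K : Subgroup B)

/-! ### Measurability of the components -/

section Measurability

variable [MeasurableSpace A] [MeasurableSpace B]

/-- A set in the double coset space is measurable iff its preimage in `A × B` is (row 44's quotient
σ-algebra). -/
theorem measurableSet_fullQuotient_iff {t : Set (FullQuotient H K)} :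
    MeasurableSet t ↔ MeasurableSet (DoubleCoset.mk H (rightLevel A K) ⁻¹' t) :=
  Iff.rfl

/-- For `K` open, every component `range (toFull q)` is measurable: its preimage in `A × B` is
open (row 39), hence Borel. -/
theorem measurableSet_range_toFull [TopologicalSpace A] [TopologicalSpace B]
    [OpensMeasurableSpace (A × B)] [ContinuousMul A] [ContinuousMul B] (hK : IsOpen (K : Set B))
    (q : FiniteQuotient H K) : MeasurableSet (Set.range (toFull q)) :=
  (measurableSet_fullQuotient_iff H K).2
    ((continuous_mk H (rightLevel A K)).isOpen_preimage _ (isOpen_range_toFull H K hK q)).measurableSet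

/-- Row 39's action of `A` on the double coset space is measurable for the quotient σ-algebra. -/
instance instMeasurableConstSMul [MeasurableMul (A × B)] : MeasurableConstSMul A (FullQuotient H K) where
  measurable_const_smul a := by
    refine measurable_from_quotient.2 ?_
    have h : (fun x : A × B => a • DoubleCoset.mk H (rightLevel A K) x) =
        DoubleCoset.mk H (rightLevel A K) ∘ fun x => x * MonoidHom.inl A B a⁻¹ := by
      funext x
      exact smul_mk H K a x
    exact h ▸ measurable_quotient_mk''.comp (measurable_mul_const _)

end Measurability

/-- The components are `A`-invariant sets: `(a • ·) ⁻¹' range (toFull q) = range (toFull q)`. -/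
theorem preimage_smul_range_toFull (a : A) (q : FiniteQuotient H K) :
    (fun t : FullQuotient H K => a • t) ⁻¹' Set.range (toFull q) = Set.range (toFull q) := by
  ext t
  simp only [Set.mem_preimage, range_toFull, Set.mem_singleton_iff, finitePart_smul]

/-! ### The Hilbert sum over the components -/

section HilbertSum

variable [TopologicalSpace A] [TopologicalSpace B] [MeasurableSpace A] [MeasurableSpace B]
  [OpensMeasurableSpace (A × B)] [ContinuousMul A] [ContinuousMul B] (hK : IsOpen (K : Set B))
  (ν : Measure (FullQuotient H K))

/-- **«L^{K_f} = ⊕_{i=1}^{h} L²(Γ_i\G_∞)»**: for `K` open and finitely many components (any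
`Fintype` structure on `H_B\B/K` — row 39's `finite_finiteQuotient` supplies one when the double
coset space is compact), `L²(FullQuotient H K, ν)` is the Hilbert sum of the subspaces `V_q` of
functions supported on the components `range (toFull q)` (row 19's `isHilbertSum_V`). -/
theorem isHilbertSum_components [Fintype (FiniteQuotient H K)] :
    IsHilbertSum ℂ (fun q : FiniteQuotient H K =>
        (V (𝕜 := ℂ) (E := ℂ) (μ := ν) (measurableSet_range_toFull H K hK q) :
          Submodule ℂ (Lp ℂ 2 ν)))
      (fun q => (V (𝕜 := ℂ) (E := ℂ) (μ := ν) (measurableSet_range_toFull H K hK q)).subtypeₗᵢ) :=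
  isHilbertSum_V (measurableSet_range_toFull H K hK) pairwise_disjoint_range_toFull
    iUnion_range_toFull

/-- The compact case: `h = #(H_B\B/K) < ∞` (row 39) and the Hilbert-sum decomposition, together. -/
theorem exists_fintype_isHilbertSum_components [CompactSpace (FullQuotient H K)] :
    ∃ _ : Fintype (FiniteQuotient H K),
      IsHilbertSum ℂ (fun q : FiniteQuotient H K =>
        (V (𝕜 := ℂ) (E := ℂ) (μ := ν) (measurableSet_range_toFull H K hK q) :
          Submodule ℂ (Lp ℂ 2 ν)))
      (fun q => (V (𝕜 := ℂ) (E := ℂ) (μ := ν) (measurableSet_range_toFull H K hK q)).subtypeₗᵢ) :=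
  haveI : Finite (FiniteQuotient H K) := finite_finiteQuotient H K hK
  letI : Fintype (FiniteQuotient H K) := Fintype.ofFinite _
  ⟨this, isHilbertSum_components H K hK ν⟩

/-- **«… as unitary G_∞-modules»**: each `V_q` is stable under row 39's regular representation of
`A = G_∞` on `L²(FullQuotient H K, ν)` (row 19's `compMeasurePreserving_mem_V`). -/
theorem regularRep_mem_V [MeasurableMul (A × B)] [SMulInvariantMeasure A (FullQuotient H K) ν]
    (a : A) (q : FiniteQuotient H K) {f : Lp ℂ 2 ν}
    (hf : f ∈ V (𝕜 := ℂ) (E := ℂ) (μ := ν) (measurableSet_range_toFull H K hK q)) :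
    regularRep ν a f ∈ V (𝕜 := ℂ) (E := ℂ) (μ := ν) (measurableSet_range_toFull H K hK q) := by
  rw [regularRep_apply]
  exact compMeasurePreserving_mem_V (measurePreserving_smul a⁻¹ ν) _
    (preimage_smul_range_toFull H K a⁻¹ q) hf

end HilbertSum

end Summit.Ventures.HodgeRepro2.T5ComponentHilbertSum
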